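import Mathlib
import HarnessLib
import Summits.Langlands.Langlands.Theses.SkinnerWilesDefectOne
import Summits.Langlands.Langlands.Theorems.ReducibleOrdinaryProModular.Negative.LevelAndRamification
import Literature.NumberTheory.GaloisRepresentations.NearlyOrdinaryDeformationRing
import Literature.NumberTheory.GaloisRepresentations.NearlyOrdinaryDeformationRingProofs
import Literature.NumberTheory.GaloisRepresentations.PadicIntermediateFieldIntegers
import Summits.Langlands.Langlands.Theorems.SkinnerWilesDefectOneReducibleOrdinaryProModularDefs
import Summits.Langlands.Langlands.Theorems.SkinnerWilesDefectOneReducibleOrdinaryProModularOrientedSteinbergDatumDatumAux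
import Summits.Langlands.Langlands.Theorems.SkinnerWilesDefectOneReducibleOrdinaryProModularOrientedSteinbergDatum

/-! # The Skinner–Wiles oriented datum at level `S♯ ∪ {v₀}` is a LOCAL INTEGRAL point: stub
`stub_orientedLocalDatum` of line steinberg-hyperplane (crux ReducibleOrdinaryProModular, stmt-Langlands-12919)

From the crux data — `F` imaginary quadratic, `p` odd, `ρ : Γ_F → GL₂(ℚ̄_p)` continuous, irreducible, almost
everywhere unramified, with an integral model `ρ₀` over the valuation ring `O` of `ℚ̄_p` that is upper triangular
modulo `𝔪_O`, `p`-distinguished and Skinner–Wiles oriented ordinary at every `v ∣ p` (`OrdLoc`) — and ANY finite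
place `v₀` (no Taylor–Steinberg hypothesis), we construct `M : ModelData F p` with
`M.Models ρ ρ₀ (baseLevel ρ ∪ {v₀})` AND `M.IsLocalPoint`.

The model is the one of the landed stub `stub_orientedSteinbergDatum` (same assembly, re-run with the
`𝒪_E`-valued specialisation kept in hand): the oriented residual datum `𝒟` over `𝒪_E` (`E/ℚ_p` finite) of
`OrientedDatum.datum_exists` (`…OrientedSteinbergDatumDatumAux`), the universal nearly ordinary deformation ring
`𝓡` of `𝒟` (Calegari–Mazur §2.2 for any `p`: the tree's `nonempty_rigidData`, `finite_carrier_dualCNL`,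
`nonempty_deformationRing`), and the specialisation `φ = (𝒪_E ↪ E ↪ ℚ̄_p) ∘ φ_E` with `φ_E : 𝓡.R →ₐ[𝒪_E] 𝒪_E`
classifying the descended lattice `ρ_E` (`𝓡.universal`).  Locality: `𝒪_E = {‖x‖ ≤ 1} ∩ E`, so `‖φ r‖ ≤ 1`
for all `r`; `φ_E` is a LOCAL homomorphism (`NearlyOrdinaryDeformationRing.isLocalHom_algHom`: it is compatible
with the augmentations onto `k_E`), so `r ∈ 𝔪_R ⇒ φ_E r ∈ 𝔪_{𝒪_E} = {‖x‖ < 1}` and `‖φ r‖ < 1`.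

References: Skinner–Wiles, Publ. Math. IHÉS 89 (1999), §2.1; Calegari–Mazur, J. Inst. Math. Jussieu 8 (2009),
§2.2; Mazur, *An introduction to the deformation theory of Galois representations* (1997), §2, §8.
-/

set_option linter.dupNamespace false
set_option autoImplicit false

namespace Summit.Langlands.Langlands.Cruxes.ReducibleOrdinaryProModular.SteinbergHyperplane

open scoped NumberField MatrixGroups
open Filter NumberField IsDedekindDomain Field Polynomial Matrix
open Literature.NumberTheory.Automorphic Literature.NumberTheory.Automorphic.BigHeckeGLn
open Literature.NumberTheory.GaloisRepresentations
open Summit.Langlands.Langlands.Theses.SkinnerWilesDefectOne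

noncomputable section

namespace OrientedDatum

variable {p : ℕ} [Fact p.Prime]

/-- The inclusion `𝒪_E ⊆ E ⊆ ℚ̄_p` lands in the valuation ring of `ℚ̄_p`: `v(x) ≤ 1` for `x ∈ 𝒪_E`. [folklore] -/
theorem valuation_coe_integers_le_one (E : IntermediateField ℚ_[p] (PadicAlgCl p))
    (x : intermediateFieldIntegers p E) : Valued.v ((x : E) : PadicAlgCl p) ≤ 1 := by
  have h : ‖((x : E) : PadicAlgCl p)‖ ≤ 1 := (mem_intermediateFieldIntegers_iff E (x : E)).1 x.2
  rw [PadicAlgCl.valuation_def, ← NNReal.coe_le_coe, coe_nnnorm, NNReal.coe_one]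
  exact h

/-- The inclusion `𝒪_E ⊆ ℚ̄_p` takes the maximal ideal of `𝒪_E` into the open unit ball: `v(x) < 1` for
`x ∈ 𝔪_{𝒪_E}`. [folklore] -/
theorem valuation_coe_integers_lt_one (E : IntermediateField ℚ_[p] (PadicAlgCl p))
    {x : intermediateFieldIntegers p E} (hx : x ∈ IsLocalRing.maximalIdeal (intermediateFieldIntegers p E)) :
    Valued.v ((x : E) : PadicAlgCl p) < 1 := by
  have h : ‖((x : E) : PadicAlgCl p)‖ < 1 := norm_lt_one_of_mem_maximalIdeal E hx
  rw [PadicAlgCl.valuation_def, ← NNReal.coe_lt_coe, coe_nnnorm, NNReal.coe_one]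
  exact h

end OrientedDatum

/-- **The Skinner–Wiles oriented datum at level `S♯ ∪ {v₀}` is a local integral point** (stub
`stub_orientedLocalDatum` of line steinberg-hyperplane): from the crux data and any place `v₀`, a model
`M : ModelData F p` — coefficient ring `𝒪_E` for a finite `E/ℚ_p`, Ribet's non-split end lattice with the ordered
residual diagonal of `ρ₀` and oriented ordinary frames at `v ∣ p`, the universal nearly ordinary deformation ring
of the resulting datum (Calegari–Mazur §2.2, any `p`) and the specialisation `φ = (𝒪_E ↪ ℚ̄_p) ∘ φ_E` classifying
the lattice — with `M.Models ρ ρ₀ (baseLevel ρ ∪ {v₀})` and `M.IsLocalPoint` (`‖φ r‖ ≤ 1` everywhere and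
`‖φ r‖ < 1` on `𝔪_R`, as `φ_E` is a local `𝒪_E`-algebra map). [cite: SkinnerWiles1999, §2.1] -/
theorem stub_orientedLocalDatum :
    ∀ (F : Type) [Field F] [NumberField F], IsTotallyComplex F → Module.finrank ℚ F = 2 →
      ∀ (p : ℕ) [Fact p.Prime], p ≠ 2 →
      ∀ (O : ValuationSubring (PadicAlgCl p)),
        O = (Valued.v : Valuation (PadicAlgCl p) NNReal).valuationSubring →
      ∀ (ρ : FramedGaloisRep F (PadicAlgCl p) 2) (ρ₀ : absoluteGaloisGroup F →* GL (Fin 2) O),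
        ρ.toGaloisRep.IsIrreducible → (∀ᶠ v in cofinite, ρ.IsUnramifiedAt v) →
        ρ.HasUpperTriangularIntegralModel ρ₀ → OrdLoc p O ρ ρ₀ →
        ∀ v₀ : HeightOneSpectrum (𝓞 F),
          ∃ M : ModelData F p, M.Models ρ ρ₀ (baseLevel ρ ∪ {v₀}) ∧ M.IsLocalPoint := by
  intro F _ _ _ _ p _ _ O hO ρ ρ₀ hirr hunr hint hloc v₀
  obtain ⟨E, hEfin, 𝒟, ρE, T, hS, hup, hdiag, hsc, hdist, hor, hdef, hρE⟩ :=
    OrientedDatum.datum_exists hO ρ ρ₀ hirr hint hloc (baseLevel ρ ∪ {v₀})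
      (OrientedDatum.finite_baseLevel_union ρ hunr v₀) Set.subset_union_left
  haveI := hEfin
  haveI : Finite (IsLocalRing.ResidueField (intermediateFieldIntegers p E)) :=
    intermediateFieldIntegers.finite_residueField E
  haveI : IsDiscreteValuationRing (intermediateFieldIntegers p E) := OrientedDatum.isDiscreteValuationRing_integers E
  haveI : CharP (IsLocalRing.ResidueField (intermediateFieldIntegers p E)) p :=
    OrientedDatum.charP_residueField_integers E
  -- the universal nearly ordinary deformation ring of `𝒟` (Calegari–Mazur §2.2, any `p`)
  obtain ⟨RD⟩ := 𝒟.nonempty_rigidData (Fact.out : p.Prime) hsc hdist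
  obtain ⟨𝓡⟩ := RD.nonempty_deformationRing (RD.finite_carrier_dualCNL 𝒟.residueMap_surjective)
  -- the specialisation `φ_E : R → 𝒪_E` classifying `ρ_E`; it is a local homomorphism
  have hsurj : Function.Surjective
      (Algebra.ofId (intermediateFieldIntegers p E) (IsLocalRing.ResidueField (intermediateFieldIntegers p E))) :=
    fun x => by
      obtain ⟨y, hy⟩ := IsLocalRing.residue_surjective x
      exact ⟨y, hy⟩
  obtain ⟨φ, ⟨P, -, hP⟩, -⟩ := 𝓡.universal (intermediateFieldIntegers p E) (Algebra.ofId _ _) hsurj ρE hdef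
  haveI : IsLocalHom (φ : 𝓡.R →+* intermediateFieldIntegers p E) := 𝓡.isLocalHom_algHom _ hsurj φ
  set emb : intermediateFieldIntegers p E →+* PadicAlgCl p :=
    (algebraMap E (PadicAlgCl p)).comp (intermediateFieldIntegers p E).subtype with hemb
  refine ⟨{ 𝒪 := intermediateFieldIntegers p E, k := IsLocalRing.ResidueField (intermediateFieldIntegers p E),
            𝒟 := 𝒟, 𝓡 := 𝓡, φ := emb.comp (φ : 𝓡.R →+* intermediateFieldIntegers p E) }, ?_,
    fun r => OrientedDatum.valuation_coe_integers_le_one E (φ r),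
    fun r hr => OrientedDatum.valuation_coe_integers_lt_one E
      (map_nonunit (φ : 𝓡.R →+* intermediateFieldIntegers p E) r hr)⟩
  refine ⟨hup, hdiag, hsc, hdist, hor, hS, T⁻¹ * Matrix.GeneralLinearGroup.map emb P, fun g => ?_⟩
  change Matrix.GeneralLinearGroup.map (emb.comp (φ : 𝓡.R →+* intermediateFieldIntegers p E)) (𝓡.ρ g) = _
  have h1 : Matrix.GeneralLinearGroup.map (φ : 𝓡.R →+* intermediateFieldIntegers p E) (𝓡.ρ g) =
      P⁻¹ * ρE g * P := by
    have := hP g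
    rw [MonoidHom.comp_apply] at this
    rw [this]; group
  rw [Matrix.GeneralLinearGroup.map_comp, MonoidHom.comp_apply, h1, map_mul, map_mul, map_inv, hρE g]
  group

end

end Summit.Langlands.Langlands.Cruxes.ReducibleOrdinaryProModular.SteinbergHyperplane
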